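import Mathlib
import HarnessLib
import Summits.HubbardSuperconductivity.HubbardSuperconductivity.Theorems.KLProgrammeKLRegimeVolumeLimitLastScaleWindowedRowsDoor
import Summits.HubbardSuperconductivity.HubbardSuperconductivity.Theorems.KLProgrammeKLRegimeVolumeLimitLastScaleFarRows
import Summits.HubbardSuperconductivity.HubbardSuperconductivity.Theorems.KLProgrammeKLRegimeTwoVolumeSourceSmoothDefs

/-!
# K3 VL child (stmt-HubbardSuperconductivity-20440), window key «(VL)-SRC-WINDOW» (pen (R235) KEY = WINDOW), binder `R.WF2` («VL-R-WF2», (R223)(A1)):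
# THE POSITION-SPACE END DOORS FOR WINDOW-DRESSED SOURCE LEGS — part A: doors (a)W, (b)W, (f)W
# (cell gate-hubbard-kl, seat hubbard-kl-k3c4-p1 g17; the W-twins of `…VolumeLimitLastScalePlainRowsDoor` (a)/(b) and `…VolumeLimitLastScaleFarRows` (f),
# keyed by p1 g22's bottom Fourier step `…LastScaleWindowedRowsDoor.norm_klSelfEnergy_sub_le_familyDualDefect`)

Under the window key the END chain's position-space currency is the WINDOW-DRESSED two-leg kernel
`W^χ_V := sectorisedKernel V M β (srcWindowFamily V M) (𝒱_V[K_V]) 2` (`K_V = klFlowFrameU V M β U μ (n_β+1)`, scale `n_β+1`, spin `0`) in place of the plain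
`sectorisedKernel V M β (trivialMultiplier V M) (𝒱_V[K_V]) 2`.  The three doors below are the plain doors VERBATIM with that one substitution in the
hypothesis text; the conclusion is the registered text of `stub_vl_nestedFramed` with binder `R.WF2` throughout.
* (a)W `framedNestedFlowTextV17F2_of_windowRowsDualDefect_wf2` — dual currency per Matsubara integer `n`; proof = p1 g22's
  `norm_klSelfEnergy_sub_le_familyDualDefect` at `F := srcWindowFamily`, the kept-label hypothesis `F 0 (ω,k⃗) = 1` discharged by
  `srcWindowWt_eq_one` once `M ≥ 2(2|n|+1)` (absorbed into the door's `∃ M₀`: `M₀ ↦ max M₀ (2(2|n|+1))`);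
* (b)W `framedNestedFlowTextV17F2_of_windowRowsPinnedDefect_wf2` — pinned currency, label-free (generic `dualRows_le_pinnedDefect`);
* (f)W `framedNestedFlowTextV17F2_of_windowNearDefect_weightedRows_wf2` — NEAR pinned defect + `ε`-weighted fine rows `≤ B` (generic
  `twoEps_sum_far_le_of_weightedRows`, `tendsto_farRate`).
Part B (`…VolumeLimitV12EndDoorsWB`) continues with the glued position-space door (g)W and the keyed top (= `stub_vl_windowedEndDoor` of the v12W image).

Honest framing: door composition; nothing asserts any door's hypothesis, any stub, K3, VL or superconductivity.
[cite: BenfattoGiulianiMastropietro2006, §2.4 (2.38), §2.9 (4.3)-(4.6)]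
-/

noncomputable section

open Finset Filter Topology Complex Literature.MathematicalPhysics.QuantumLattice Literature.Probability.LatticeModels GrassmannAlgebra
open Summit.HubbardSuperconductivity.HubbardSuperconductivity.Theorems.EngineV8
open Summit.HubbardSuperconductivity.HubbardSuperconductivity.Theorems.KLProgrammeLegKernels
open Summit.HubbardSuperconductivity.HubbardSuperconductivity.Theorems.KLRegimeSplit
open Summit.HubbardSuperconductivity.HubbardSuperconductivity.Theorems.TwoPointAssembly
open Summit.HubbardSuperconductivity.HubbardSuperconductivity.Theorems.TwoVolumeDefect
open Summit.HubbardSuperconductivity.HubbardSuperconductivity.Theorems.TwoVolumeSource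

set_option linter.dupNamespace false -- summit = problem name (single-conjunct summit), D-0017

namespace Summit.HubbardSuperconductivity.HubbardSuperconductivity.Theorems.TwoVolumeDefect

/-- **DOOR (a)W — OWN FRAMES, DUAL CURRENCY, WINDOW-DRESSED ROWS.**  The registered text of `stub_vl_nestedFramed` from: per Matsubara integer `n`, `∃ L₀ δ→0`,
for `L ≥ L₀`, `L″ = b·L`, eventually in `M`, pins `o_c, o_f` with `2ε·(Ddef₊ + Dfar₊) ≤ δ L` at every label of integer `n` — rows of the WINDOW-DRESSED two-leg
kernels `W^χ` of `𝒱_L[K_L]` and `𝒱_{L″}[K_{L″}]`, `K_V = klFlowFrameU V M β U μ (n_β+1)`, spin `0`, scale `n_β+1`.  Rate `ρ = δ`, threshold `M₀ ↦ max M₀ (2(2|n|+1))` (the window is `1` at the read label); no tower datum is used.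
[cite: BenfattoGiulianiMastropietro2006, §2.4 (2.38)] -/
theorem framedNestedFlowTextV17F2_of_windowRowsDualDefect_wf2
    (hD : ∀ (G : GeoConsts) (P : SplitConsts) (Q : EngConsts) (R : RenConsts), G.WF → P.WF → Q.WF → R.WF2 →
      ∃ c₅ : ℝ, 0 < c₅ ∧ ∀ c : ℝ, 0 < c → c ≤ c₅ → ∃ U₀ : ℝ, 0 < U₀ ∧
        ∀ μ ∈ klWindowC, ∀ U : ℝ, 0 < U → U ≤ U₀ → ∀ β : ℝ, klBetaMin ≤ β → β ≤ Real.exp (c / U ^ 2) →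
          ∀ K : TrigPolyC4v, klPredsV17F2.frameOK R U (nScales β) μ K →
            ∀ (Lstar : ℕ) (Mstar : ℕ → ℕ), TowerP klPredsV17F2 G P Q R β U μ K Lstar Mstar →
              ∀ n : ℤ, ∃ L₀ : ℕ, ∃ δ : ℕ → ℝ, Tendsto δ atTop (𝓝 0) ∧
                ∀ (L : ℕ) [NeZero L], L₀ ≤ L → ∀ (L'' : ℕ) [NeZero L''] (b : ℕ), L'' = b * L → ∃ M₀ : ℕ, ∀ (M : ℕ) [NeZero M], M₀ ≤ M →
                  ∃ (oc : SpaceTimeIdx L M) (of : SpaceTimeIdx L'' M), ∀ ω : MatsubaraIdx M, matsubaraInt M ω = n →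
                    2 * imagTimeWeight β M *
                      ((∑ ybar : TorusSite 2 L,
                          ‖(∑ t₁ : ImagTimeIdx M,
                              sectorisedKernel L M β (srcWindowFamily L M)
                                  (klEffectiveAction L M β U μ (klFlowFrameU L M β U μ (nScales β + 1)) klE0 (nScales β + 1)) 2
                                  (![((0, 0), 0), ((0, 0), 1)] : Fin 2 → SectorLeg 1) ![oc, (t₁, oc.2 + ybar)] *
                                Complex.exp (((matsubaraFreq β M ω * (imagTime β M oc.1 - imagTime β M t₁) : ℝ) : ℂ) * I)) -
                            (∑ t₁ : ImagTimeIdx M,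
                              sectorisedKernel L'' M β (srcWindowFamily L'' M)
                                  (klEffectiveAction L'' M β U μ (klFlowFrameU L'' M β U μ (nScales β + 1)) klE0 (nScales β + 1)) 2
                                  (![((0, 0), 0), ((0, 0), 1)] : Fin 2 → SectorLeg 1) ![of, (t₁, of.2 + Torus.proj L'' (Torus.cRep ybar))] *
                                Complex.exp (((matsubaraFreq β M ω * (imagTime β M of.1 - imagTime β M t₁) : ℝ) : ℂ) * I))‖) +
                        ∑ y ∈ univ.filter (fun y : TorusSite 2 L'' => Torus.proj L'' (Torus.cRep (fun i => (((y i).val : ℕ) : ZMod L))) ≠ y),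
                          ‖∑ t₁ : ImagTimeIdx M,
                              sectorisedKernel L'' M β (srcWindowFamily L'' M)
                                  (klEffectiveAction L'' M β U μ (klFlowFrameU L'' M β U μ (nScales β + 1)) klE0 (nScales β + 1)) 2
                                  (![((0, 0), 0), ((0, 0), 1)] : Fin 2 → SectorLeg 1) ![of, (t₁, of.2 + y)] *
                                Complex.exp (((matsubaraFreq β M ω * (imagTime β M of.1 - imagTime β M t₁) : ℝ) : ℂ) * I)‖) ≤ δ L) :
    ∀ (G : GeoConsts) (P : SplitConsts) (Q : EngConsts) (R : RenConsts), G.WF → P.WF → Q.WF → R.WF2 →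
      ∃ c₅ : ℝ, 0 < c₅ ∧ ∀ c : ℝ, 0 < c → c ≤ c₅ → ∃ U₀ : ℝ, 0 < U₀ ∧
        ∀ μ ∈ klWindowC, ∀ U : ℝ, 0 < U → U ≤ U₀ → ∀ β : ℝ, klBetaMin ≤ β → β ≤ Real.exp (c / U ^ 2) →
          ∀ K : TrigPolyC4v, klPredsV17F2.frameOK R U (nScales β) μ K →
            ∀ (Lstar : ℕ) (Mstar : ℕ → ℕ), TowerP klPredsV17F2 G P Q R β U μ K Lstar Mstar →
              ∀ n : ℤ, ∃ L₀ : ℕ, ∃ ρ : ℕ → ℝ, Tendsto ρ atTop (𝓝 0) ∧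
                ∀ (L : ℕ) [NeZero L], L₀ ≤ L → ∀ (L'' : ℕ) [NeZero L''], L ∣ L'' → ∃ M₀ : ℕ, ∀ (M : ℕ) [NeZero M], M₀ ≤ M →
                  ∀ (ω : MatsubaraIdx M), matsubaraInt M ω = n → ∀ (k : TorusSite 2 L) (k'' : TorusSite 2 L''),
                    latticeMomentum L'' k'' = latticeMomentum L k →
                      ‖klSelfEnergy L M β U μ (klFlowFrameU L M β U μ (nScales β + 1)) klE0 (nScales β + 1) (ω, k) 0 -
                          klSelfEnergy L'' M β U μ (klFlowFrameU L'' M β U μ (nScales β + 1)) klE0 (nScales β + 1) (ω, k'') 0‖ ≤ ρ L := by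
  intro G P Q R hG hP hQ hR
  obtain ⟨c₅, hc₅, hc⟩ := hD G P Q R hG hP hQ hR
  refine ⟨c₅, hc₅, fun c hc0 hcc => ?_⟩
  obtain ⟨U₀, hU₀, hU⟩ := hc c hc0 hcc
  refine ⟨U₀, hU₀, fun μ hμ U hU0 hUU β hβmin hβmax K hK Lstar Mstar hT n => ?_⟩
  have hβ : 0 < β := KLRegimeSplit.pos_of_klBetaMin_le hβmin
  obtain ⟨L₀, δ, hδ, hDn⟩ := hU μ hμ U hU0 hUU β hβmin hβmax K hK Lstar Mstar hT n
  refine ⟨L₀, δ, hδ, fun L _ hL L'' _ hdvd => ?_⟩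
  obtain ⟨b, hb⟩ := hdvd
  have hb' : L'' = b * L := by rw [hb, mul_comm]
  obtain ⟨M₀, hM₀⟩ := hDn L hL L'' b hb'
  -- the window is `1` at the read label once `M ≥ 2(2|n|+1)`
  refine ⟨max M₀ (2 * (2 * n.natAbs + 1)), fun M _ hM ω hω k k'' hk => ?_⟩
  obtain ⟨oc, of, hw⟩ := hM₀ M ((le_max_left _ _).trans hM)
  have hMn : 2 * (2 * n.natAbs + 1) ≤ M := (le_max_right _ _).trans hM
  have hlab : |2 * (matsubaraInt M ω : ℝ) + 1| ≤ (M : ℝ) / 2 := by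
    rw [hω]
    have h2 : ((2 * (2 * n.natAbs + 1) : ℕ) : ℝ) ≤ (M : ℝ) := by exact_mod_cast hMn
    have h3 : ((n.natAbs : ℕ) : ℝ) = |(n : ℝ)| := by rw [Nat.cast_natAbs, Int.cast_abs]
    rw [Nat.cast_mul, Nat.cast_add, Nat.cast_mul, h3] at h2
    norm_num at h2
    have h4 := le_abs_self (n : ℝ)
    have h5 := neg_abs_le (n : ℝ)
    rw [abs_le]
    constructor <;> linarith
  have hFc : ∀ kv : TorusSite 2 L, srcWindowFamily L M 0 (ω, kv) = 1 := fun kv => by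
    show (((srcWindowWt M ω : ℝ)) : ℂ) = 1
    rw [srcWindowWt_eq_one hlab]; simp
  have hFf : ∀ kv : TorusSite 2 L'', srcWindowFamily L'' M 0 (ω, kv) = 1 := fun kv => by
    show (((srcWindowWt M ω : ℝ)) : ℂ) = 1
    rw [srcWindowWt_eq_one hlab]; simp
  exact (norm_klSelfEnergy_sub_le_familyDualDefect hb' hβ U μ _ _ (nScales β + 1) ω 0 (srcWindowFamily L M) (srcWindowFamily L'' M)
    hFc hFf oc of hk).trans (hw ω hω)

end Summit.HubbardSuperconductivity.HubbardSuperconductivity.Theorems.TwoVolumeDefect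

namespace Summit.HubbardSuperconductivity.HubbardSuperconductivity.Theorems.TwoVolumeDefect

/-- **DOOR (b)W — OWN FRAMES, PINNED CURRENCY, LABEL-FREE HYPOTHESIS, WINDOW-DRESSED KERNELS.**  The registered text of `stub_vl_nestedFramed` from: `∃ L₀ δ→0`, for `L ≥ L₀`,
`L″ = b·L`, eventually in `M`, pins `o_c, o_f` WITH A COMMON TIME such that the pinned `ℓ¹` two-volume defect (phases dropped, times summed) of the window-dressed
two-leg kernels `W^χ` of `𝒱_L[K_L]` vs `𝒱_{L″}[K_{L″}]` plus the far rows of `𝒱_{L″}[K_{L″}]` is `≤ δ L / (2ε)` — one datum for every Matsubara label at once.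
[cite: BenfattoGiulianiMastropietro2006, §2.4 (2.38)] -/
theorem framedNestedFlowTextV17F2_of_windowRowsPinnedDefect_wf2
    (hD : ∀ (G : GeoConsts) (P : SplitConsts) (Q : EngConsts) (R : RenConsts), G.WF → P.WF → Q.WF → R.WF2 →
      ∃ c₅ : ℝ, 0 < c₅ ∧ ∀ c : ℝ, 0 < c → c ≤ c₅ → ∃ U₀ : ℝ, 0 < U₀ ∧
        ∀ μ ∈ klWindowC, ∀ U : ℝ, 0 < U → U ≤ U₀ → ∀ β : ℝ, klBetaMin ≤ β → β ≤ Real.exp (c / U ^ 2) →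
          ∀ K : TrigPolyC4v, klPredsV17F2.frameOK R U (nScales β) μ K →
            ∀ (Lstar : ℕ) (Mstar : ℕ → ℕ), TowerP klPredsV17F2 G P Q R β U μ K Lstar Mstar →
              ∃ L₀ : ℕ, ∃ δ : ℕ → ℝ, Tendsto δ atTop (𝓝 0) ∧
                ∀ (L : ℕ) [NeZero L], L₀ ≤ L → ∀ (L'' : ℕ) [NeZero L''] (b : ℕ), L'' = b * L → ∃ M₀ : ℕ, ∀ (M : ℕ) [NeZero M], M₀ ≤ M →
                  ∃ (oc : SpaceTimeIdx L M) (of : SpaceTimeIdx L'' M), of.1 = oc.1 ∧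
                    2 * imagTimeWeight β M *
                      ((∑ t₁ : ImagTimeIdx M, ∑ ybar : TorusSite 2 L,
                          ‖sectorisedKernel L M β (srcWindowFamily L M)
                                (klEffectiveAction L M β U μ (klFlowFrameU L M β U μ (nScales β + 1)) klE0 (nScales β + 1)) 2
                                (![((0, 0), 0), ((0, 0), 1)] : Fin 2 → SectorLeg 1) ![oc, (t₁, oc.2 + ybar)] -
                            sectorisedKernel L'' M β (srcWindowFamily L'' M)
                                (klEffectiveAction L'' M β U μ (klFlowFrameU L'' M β U μ (nScales β + 1)) klE0 (nScales β + 1)) 2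
                                (![((0, 0), 0), ((0, 0), 1)] : Fin 2 → SectorLeg 1) ![of, (t₁, of.2 + Torus.proj L'' (Torus.cRep ybar))]‖) +
                        ∑ t₁ : ImagTimeIdx M,
                          ∑ y ∈ univ.filter (fun y : TorusSite 2 L'' => Torus.proj L'' (Torus.cRep (fun i => (((y i).val : ℕ) : ZMod L))) ≠ y),
                            ‖sectorisedKernel L'' M β (srcWindowFamily L'' M)
                                (klEffectiveAction L'' M β U μ (klFlowFrameU L'' M β U μ (nScales β + 1)) klE0 (nScales β + 1)) 2
                                (![((0, 0), 0), ((0, 0), 1)] : Fin 2 → SectorLeg 1) ![of, (t₁, of.2 + y)]‖) ≤ δ L) :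
    ∀ (G : GeoConsts) (P : SplitConsts) (Q : EngConsts) (R : RenConsts), G.WF → P.WF → Q.WF → R.WF2 →
      ∃ c₅ : ℝ, 0 < c₅ ∧ ∀ c : ℝ, 0 < c → c ≤ c₅ → ∃ U₀ : ℝ, 0 < U₀ ∧
        ∀ μ ∈ klWindowC, ∀ U : ℝ, 0 < U → U ≤ U₀ → ∀ β : ℝ, klBetaMin ≤ β → β ≤ Real.exp (c / U ^ 2) →
          ∀ K : TrigPolyC4v, klPredsV17F2.frameOK R U (nScales β) μ K →
            ∀ (Lstar : ℕ) (Mstar : ℕ → ℕ), TowerP klPredsV17F2 G P Q R β U μ K Lstar Mstar →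
              ∀ n : ℤ, ∃ L₀ : ℕ, ∃ ρ : ℕ → ℝ, Tendsto ρ atTop (𝓝 0) ∧
                ∀ (L : ℕ) [NeZero L], L₀ ≤ L → ∀ (L'' : ℕ) [NeZero L''], L ∣ L'' → ∃ M₀ : ℕ, ∀ (M : ℕ) [NeZero M], M₀ ≤ M →
                  ∀ (ω : MatsubaraIdx M), matsubaraInt M ω = n → ∀ (k : TorusSite 2 L) (k'' : TorusSite 2 L''),
                    latticeMomentum L'' k'' = latticeMomentum L k →
                      ‖klSelfEnergy L M β U μ (klFlowFrameU L M β U μ (nScales β + 1)) klE0 (nScales β + 1) (ω, k) 0 -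
                          klSelfEnergy L'' M β U μ (klFlowFrameU L'' M β U μ (nScales β + 1)) klE0 (nScales β + 1) (ω, k'') 0‖ ≤ ρ L := by
  refine framedNestedFlowTextV17F2_of_windowRowsDualDefect_wf2 fun G P Q R hG hP hQ hR => ?_
  obtain ⟨c₅, hc₅, hc⟩ := hD G P Q R hG hP hQ hR
  refine ⟨c₅, hc₅, fun c hc0 hcc => ?_⟩
  obtain ⟨U₀, hU₀, hU⟩ := hc c hc0 hcc
  refine ⟨U₀, hU₀, fun μ hμ U hU0 hUU β hβmin hβmax K hK Lstar Mstar hT n => ?_⟩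
  have hβ : 0 < β := KLRegimeSplit.pos_of_klBetaMin_le hβmin
  obtain ⟨L₀, δ, hδ, hDn⟩ := hU μ hμ U hU0 hUU β hβmin hβmax K hK Lstar Mstar hT
  refine ⟨L₀, δ, hδ, fun L _ hL L'' _ b hb => ?_⟩
  obtain ⟨M₀, hM₀⟩ := hDn L hL L'' b hb
  refine ⟨M₀, fun M _ hM => ?_⟩
  obtain ⟨oc, of, ht, hdef⟩ := hM₀ M hM
  have hε : 0 ≤ 2 * imagTimeWeight β M := by have := imagTimeWeight_nonneg hβ.le M; positivity
  refine ⟨oc, of, fun ω _ => ?_⟩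
  exact (mul_le_mul_of_nonneg_left (dualRows_le_pinnedDefect _ _ β ω oc of ht) hε).trans hdef

end Summit.HubbardSuperconductivity.HubbardSuperconductivity.Theorems.TwoVolumeDefect

namespace Summit.HubbardSuperconductivity.HubbardSuperconductivity.Theorems.TwoVolumeDefect

/-- **DOOR (f)W — OWN FRAMES: NEAR PINNED DEFECT + WEIGHTED FINE-VOLUME ROWS OF THE WINDOW-DRESSED KERNELS.**  The registered text of `stub_vl_nestedFramed` from: `∃ L₀ δ→0 B`, for
`L ≥ L₀`, `L″ = b·L`, eventually in `M`, pins `o_c, o_f` with a common time such that (`W = W^χ` window-dressed) `2ε·Σ_{t₁,ȳ}‖W_L(o_c,(t₁,o⃗_c+ȳ)) − W_{L″}(o_f,(t₁,o⃗_f+ȳ↑))‖ ≤ δ L`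
(NEAR, same centred offsets) and `ε·Σ_{t₁,y}(1 + Λ_{n⋆}‖y‖_𝕋)·‖W_{L″}(o_f,(t₁,o⃗_f+y))‖ ≤ B` (the scale-`n⋆` weighted source-pair profile of the fine
volume — token #24 at `n⋆`).  The far rows of door (b) are `≤ 2B/(1 + Λ_{n⋆}((L−1)/2+1)) → 0`. [cite: BenfattoGiulianiMastropietro2006, §2.9 (4.3)-(4.6)] -/
theorem framedNestedFlowTextV17F2_of_windowNearDefect_weightedRows_wf2
    (hD : ∀ (G : GeoConsts) (P : SplitConsts) (Q : EngConsts) (R : RenConsts), G.WF → P.WF → Q.WF → R.WF2 →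
      ∃ c₅ : ℝ, 0 < c₅ ∧ ∀ c : ℝ, 0 < c → c ≤ c₅ → ∃ U₀ : ℝ, 0 < U₀ ∧
        ∀ μ ∈ klWindowC, ∀ U : ℝ, 0 < U → U ≤ U₀ → ∀ β : ℝ, klBetaMin ≤ β → β ≤ Real.exp (c / U ^ 2) →
          ∀ K : TrigPolyC4v, klPredsV17F2.frameOK R U (nScales β) μ K →
            ∀ (Lstar : ℕ) (Mstar : ℕ → ℕ), TowerP klPredsV17F2 G P Q R β U μ K Lstar Mstar →
              ∃ L₀ : ℕ, ∃ δ : ℕ → ℝ, ∃ B : ℝ, Tendsto δ atTop (𝓝 0) ∧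
                ∀ (L : ℕ) [NeZero L], L₀ ≤ L → ∀ (L'' : ℕ) [NeZero L''] (b : ℕ), L'' = b * L → ∃ M₀ : ℕ, ∀ (M : ℕ) [NeZero M], M₀ ≤ M →
                  ∃ (oc : SpaceTimeIdx L M) (of : SpaceTimeIdx L'' M), of.1 = oc.1 ∧
                    2 * imagTimeWeight β M *
                      (∑ t₁ : ImagTimeIdx M, ∑ ybar : TorusSite 2 L,
                          ‖sectorisedKernel L M β (srcWindowFamily L M)
                                (klEffectiveAction L M β U μ (klFlowFrameU L M β U μ (nScales β + 1)) klE0 (nScales β + 1)) 2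
                                (![((0, 0), 0), ((0, 0), 1)] : Fin 2 → SectorLeg 1) ![oc, (t₁, oc.2 + ybar)] -
                            sectorisedKernel L'' M β (srcWindowFamily L'' M)
                                (klEffectiveAction L'' M β U μ (klFlowFrameU L'' M β U μ (nScales β + 1)) klE0 (nScales β + 1)) 2
                                (![((0, 0), 0), ((0, 0), 1)] : Fin 2 → SectorLeg 1) ![of, (t₁, of.2 + Torus.proj L'' (Torus.cRep ybar))]‖) ≤ δ L ∧
                    imagTimeWeight β M *
                      ∑ t₁ : ImagTimeIdx M, ∑ y : TorusSite 2 L'',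
                        (1 + klScale klE0 (nScales β + 1) * (Torus.tnorm y : ℝ)) *
                          ‖sectorisedKernel L'' M β (srcWindowFamily L'' M)
                              (klEffectiveAction L'' M β U μ (klFlowFrameU L'' M β U μ (nScales β + 1)) klE0 (nScales β + 1)) 2
                              (![((0, 0), 0), ((0, 0), 1)] : Fin 2 → SectorLeg 1) ![of, (t₁, of.2 + y)]‖ ≤ B) :
    ∀ (G : GeoConsts) (P : SplitConsts) (Q : EngConsts) (R : RenConsts), G.WF → P.WF → Q.WF → R.WF2 →
      ∃ c₅ : ℝ, 0 < c₅ ∧ ∀ c : ℝ, 0 < c → c ≤ c₅ → ∃ U₀ : ℝ, 0 < U₀ ∧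
        ∀ μ ∈ klWindowC, ∀ U : ℝ, 0 < U → U ≤ U₀ → ∀ β : ℝ, klBetaMin ≤ β → β ≤ Real.exp (c / U ^ 2) →
          ∀ K : TrigPolyC4v, klPredsV17F2.frameOK R U (nScales β) μ K →
            ∀ (Lstar : ℕ) (Mstar : ℕ → ℕ), TowerP klPredsV17F2 G P Q R β U μ K Lstar Mstar →
              ∀ n : ℤ, ∃ L₀ : ℕ, ∃ ρ : ℕ → ℝ, Tendsto ρ atTop (𝓝 0) ∧
                ∀ (L : ℕ) [NeZero L], L₀ ≤ L → ∀ (L'' : ℕ) [NeZero L''], L ∣ L'' → ∃ M₀ : ℕ, ∀ (M : ℕ) [NeZero M], M₀ ≤ M →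
                  ∀ (ω : MatsubaraIdx M), matsubaraInt M ω = n → ∀ (k : TorusSite 2 L) (k'' : TorusSite 2 L''),
                    latticeMomentum L'' k'' = latticeMomentum L k →
                      ‖klSelfEnergy L M β U μ (klFlowFrameU L M β U μ (nScales β + 1)) klE0 (nScales β + 1) (ω, k) 0 -
                          klSelfEnergy L'' M β U μ (klFlowFrameU L'' M β U μ (nScales β + 1)) klE0 (nScales β + 1) (ω, k'') 0‖ ≤ ρ L := by
  refine framedNestedFlowTextV17F2_of_windowRowsPinnedDefect_wf2 fun G P Q R hG hP hQ hR => ?_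
  obtain ⟨c₅, hc₅, hc⟩ := hD G P Q R hG hP hQ hR
  refine ⟨c₅, hc₅, fun c hc0 hcc => ?_⟩
  obtain ⟨U₀, hU₀, hU⟩ := hc c hc0 hcc
  refine ⟨U₀, hU₀, fun μ hμ U hU0 hUU β hβmin hβmax K hK Lstar Mstar hT => ?_⟩
  have hβ : 0 < β := KLRegimeSplit.pos_of_klBetaMin_le hβmin
  have hΛ : 0 < klScale klE0 (nScales β + 1) := klth_klScale_pos _
  obtain ⟨L₀, δ, B, hδ, hDn⟩ := hU μ hμ U hU0 hUU β hβmin hβmax K hK Lstar Mstar hT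
  refine ⟨L₀, fun L => δ L + 2 * B / (1 + klScale klE0 (nScales β + 1) * ((((L - 1) / 2 + 1 : ℕ)) : ℝ)), ?_,
    fun L _ hL L'' _ b hb => ?_⟩
  · simpa using hδ.add (tendsto_farRate hΛ B)
  obtain ⟨M₀, hM₀⟩ := hDn L hL L'' b hb
  refine ⟨M₀, fun M _ hM => ?_⟩
  obtain ⟨oc, of, ht, hnear, hB⟩ := hM₀ M hM
  have hε : 0 ≤ imagTimeWeight β M := imagTimeWeight_nonneg hβ.le M
  refine ⟨oc, of, ht, ?_⟩
  rw [mul_add]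
  refine add_le_add hnear ?_
  exact twoEps_sum_far_le_of_weightedRows hb _ of hε hΛ.le hB

end Summit.HubbardSuperconductivity.HubbardSuperconductivity.Theorems.TwoVolumeDefect

end
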